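import Summits.QuantumFields.YangMills.Theorems.AllWindowsColdBoxBoxHighLineTiltCum5SizesU
import Summits.QuantumFields.YangMills.Theorems.AllWindowsColdBoxBoxHighLineSmallFieldInsideFPByName
import Summits.QuantumFields.YangMills.Theorems.AllWindowsColdBoxBoxHighLineSmallFieldMass

/-!
# U5-L3-concrete, β-LETTERS — `κ₅,t(c_x, c_y; tiltU)` over `μ_D` at `s = β^{−1/2+κ₃}` with EVERY hypothesis discharged for `β ≥ β₀(θ, κ₃)`
# (`Cruxes/BoxWindowHighSU2213/U5-BLOCKERS.md` §2 L3 «f‴ size»; LINE-20 U5 ⟨stmt-QuantumFields-24336⟩; pattern of w5 g23's ✓`…TiltCum4BoundBeta`)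

Width seat `ym-line-sfw-p2-w5` (prover-ym-line-sfw-p2-w5-g24-0).  ✓`GaussNormalForm.abs_tiltCum5_muD_le_dominant` (this seat, `…TiltCum5SizesU`) bounds the
fifth tilted cumulant under seven side conditions (`H⁴ ≤ β`, `s·H² ≤ c₀`, three dominance conditions, `sup_D|tiltU| ≤ 1`, `E₀[1_D] ≥ 1/2`).  Here all seven are
discharged in the window `1 ≤ H ≤ β^θ + 1`, `s = β^{−1/2+κ₃}`, for `0 < θ`, `5θ < 1`, `0 < κ₃ < (1/2 − 4θ)/3` (so in particular on U5's HIGH windows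
`θ ∈ (1/13, 1/10)`):

* ★ `TiltSup.exists_forall_abs_tiltU_le_wide` — w4 g28's ✓`TiltSup.exists_forall_abs_tiltU_le` WITHOUT the hypothesis `12θ < 1` (its three exponent checks
  `4θ < 1/2 − 3κ₃`, `6θ < 1 − 2κ₃`, `2θ < 1/2 − κ₃` follow from `κ₃ < (1/2 − 4θ)/3` alone once `5θ < 1`): `sup_D|tiltU| ≤ ε` for `β ≥ β₀`;
* `TiltSup.rpow_window_aux` — `β^γ·(β^{−1/2+κ})^n = (√β)⁻¹` when `γ + n(−1/2+κ) = −1/2`;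
* ★★ `GaussNormalForm.exists_beta0_abs_tiltCum5_muD_le` — `∃ C m, 0 ≤ C ∧ ∃ β₀ ≥ 1, ∀ β ≥ β₀, ∀ H, 1 ≤ H ≤ β^θ + 1, ∀ x y, ∀ t ∈ [0,1],`
  `|κ₅,t| ≤ C·(1+log H)^m·(((1+log H)²/β² + s³/(β√β))·(H⁶/(β√β)))` at `s = β^{−1/2+κ₃}` — i.e. `κ₅ ≲ (1+log H)^{m+2}·H⁶·β^{−7/2}`, the `hK`-type input of
  fcl-p3's ✓`tiltThirdOrder` for the U5 assembler, with nothing left to check but `β ≥ β₀`.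

Everything proved; no definitions; standard axioms.  HONEST LABEL: U5 prep, helper-grade; U5 ⟨24336⟩ UNSTAFFED/OPEN, ⟨24004⟩ OPEN; route AllWindowsColdBox DRAFT;
no crux, rung or summit is proved; **the Yang–Mills mass gap is NOT proved by this file; no summit is proved by a line.**
-/

set_option autoImplicit false

noncomputable section

open MeasureTheory Set Real
open Literature.Probability.LatticeModels (Site)

namespace Summit.QuantumFields.YangMills.Theorems.AllWindowsColdBoxBoxHighLine

namespace TiltSup

/-- ★ **`sup_D |tiltU| ≤ ε` for `β ≥ β₀`, wide window**: ✓`exists_forall_abs_tiltU_le` without `12θ < 1` — for `0 < θ`, `5θ < 1`, `κ₃ < (1/2 − 4θ)/3`, `ε > 0`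
there is `β₀ ≥ 1` such that for all `β ≥ β₀`, `1 ≤ H ≤ β^θ + 1`, every `a ∈ smallField H (β^{−1/2+κ₃})` has `|tiltU β H a| ≤ ε`. -/
theorem exists_forall_abs_tiltU_le_wide {θ κ₃ ε : ℝ} (hθ : 0 < θ) (hθ5 : 5 * θ < 1) (hκu : κ₃ < (1 / 2 - 4 * θ) / 3) (hε : 0 < ε) :
    ∃ β₀ : ℝ, 1 ≤ β₀ ∧ ∀ β : ℝ, β₀ ≤ β → ∀ H : ℕ, 1 ≤ H → (H : ℝ) ≤ β ^ θ + 1 →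
      ∀ a ∈ smallField H (β ^ (-1 / 2 + κ₃)), |tiltU β H a| ≤ ε := by
  obtain ⟨C, c₀, m, hc₀, hU⟩ := abs_tiltU_le_of ghostTaylor
  have hθ0 : 0 ≤ θ := hθ.le
  have hε2 : 0 < ε / 2 := by linarith
  obtain ⟨b₁, hb₁1, hb₁⟩ := ErrorBudget.exists_forall_natPow_log_le (k := 4) (γ := 1 / 2 - 3 * κ₃) hθ0 (by push_cast; linarith) hε2 C m 0
  obtain ⟨b₂, hb₂1, hb₂⟩ := ErrorBudget.exists_forall_natPow_log_le (k := 6) (γ := 1 - 2 * κ₃) hθ0 (by push_cast; linarith) hε2 C m 0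
  obtain ⟨b₃, hb₃1, hb₃⟩ := ErrorBudget.exists_forall_natPow_log_le (k := 2) (γ := 1 / 2 - κ₃) hθ0 (by push_cast; linarith) hc₀ 1 0 0
  refine ⟨max b₁ (max b₂ b₃), le_max_of_le_left hb₁1, fun β hβ H hH hHβ a ha => ?_⟩
  have hβ1 : b₁ ≤ β := (le_max_left _ _).trans hβ
  have hβ2 : b₂ ≤ β := ((le_max_left _ _).trans (le_max_right _ _)).trans hβ
  have hβ3 : b₃ ≤ β := ((le_max_right _ _).trans (le_max_right _ _)).trans hβ
  have hβone : 1 ≤ β := hb₁1.trans hβ1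
  have hβpos : 0 < β := by linarith
  set s : ℝ := β ^ (-1 / 2 + κ₃) with hs
  have hs0 : 0 ≤ s := Real.rpow_nonneg hβpos.le _
  have hs1 : s ≤ 1 := rpow_neg_half_add_le_one hβone (by linarith)
  have h3 := hb₃ β hβ3 H hH hHβ
  have hsH : s * (H : ℝ) ^ 2 ≤ c₀ := by
    have e : s * (H : ℝ) ^ 2 = 1 * (H : ℝ) ^ 2 * (1 + Real.log H) ^ 0 * (1 + Real.log β) ^ 0 / β ^ (1 / 2 - κ₃) := by
      rw [hs, rpow_eq_one_div hβpos, pow_zero, pow_zero]; ring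
    rw [e]; exact h3
  have hmain := hU H hH β s hs0 hs1 hsH a ha
  have h1 := hb₁ β hβ1 H hH hHβ
  have h2 := hb₂ β hβ2 H hH hHβ
  have e1 : C * (1 + Real.log H) ^ m * (|β| * (H : ℝ) ^ 4 * s ^ 3) =
      C * (H : ℝ) ^ 4 * (1 + Real.log H) ^ m * (1 + Real.log β) ^ 0 / β ^ (1 / 2 - 3 * κ₃) := by
    rw [abs_of_pos hβpos, pow_zero, hs]
    have := beta_mul_rpow_cube (κ := κ₃) hβpos
    calc C * (1 + Real.log H) ^ m * (β * (H : ℝ) ^ 4 * (β ^ (-1 / 2 + κ₃)) ^ 3)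
        = C * (1 + Real.log H) ^ m * (H : ℝ) ^ 4 * (β * (β ^ (-1 / 2 + κ₃)) ^ 3) := by ring
      _ = C * (1 + Real.log H) ^ m * (H : ℝ) ^ 4 * (1 / β ^ (1 / 2 - 3 * κ₃)) := by rw [this]
      _ = _ := by ring
  have e2 : C * (1 + Real.log H) ^ m * ((H : ℝ) ^ 6 * s ^ 2) =
      C * (H : ℝ) ^ 6 * (1 + Real.log H) ^ m * (1 + Real.log β) ^ 0 / β ^ (1 - 2 * κ₃) := by
    rw [pow_zero, hs, rpow_sq_eq hβpos]; ring
  have hsplit : C * (1 + Real.log H) ^ m * (|β| * (H : ℝ) ^ 4 * s ^ 3 + (H : ℝ) ^ 6 * s ^ 2) =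
      C * (1 + Real.log H) ^ m * (|β| * (H : ℝ) ^ 4 * s ^ 3) + C * (1 + Real.log H) ^ m * ((H : ℝ) ^ 6 * s ^ 2) := by ring
  rw [hsplit, e1, e2] at hmain
  linarith

/-- `β^γ · (β^{−1/2+κ})^n = (√β)⁻¹` whenever `γ + n·(−1/2+κ) = −1/2` (`β > 0`). -/
theorem rpow_window_aux {β κ γ : ℝ} (hβ : 0 < β) (n : ℕ) (hγ : γ + n * (-1 / 2 + κ) = -1 / 2) :
    β ^ γ * (β ^ (-1 / 2 + κ)) ^ n = (Real.sqrt β)⁻¹ := by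
  rw [← Real.rpow_natCast (β ^ (-1 / 2 + κ)) n, ← Real.rpow_mul hβ.le, ← Real.rpow_add hβ,
    show γ + (-1 / 2 + κ) * (n : ℝ) = -(1 / 2) by linarith, Real.rpow_neg hβ.le, Real.sqrt_eq_rpow]

end TiltSup

namespace GaussNormalForm

/-- ★★ **`κ₅,t` in β-letters, every hypothesis discharged**: for `0 < θ`, `5θ < 1`, `0 < κ₃ < (1/2 − 4θ)/3` there are `C ≥ 0`, `m` and `β₀ ≥ 1` such that for
all `β ≥ β₀`, `1 ≤ H ≤ β^θ + 1`, base points `x, y` and `t ∈ [0,1]`, with `s = β^{−1/2+κ₃}` and `μ_D = 1_{smallField H s}·(Hodge Gaussian)`: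
`|κ₅,t(c_x, c_y; tiltU)| ≤ C·(1+log H)^m·(((1+log H)²/β² + s³/(β√β))·(H⁶/(β√β)))`. -/
theorem exists_beta0_abs_tiltCum5_muD_le {θ κ₃ : ℝ} (hθ : 0 < θ) (hθ5 : 5 * θ < 1) (hκ0 : 0 < κ₃) (hκu : κ₃ < (1 / 2 - 4 * θ) / 3) :
    ∃ C : ℝ, ∃ m : ℕ, 0 ≤ C ∧ ∃ β₀ : ℝ, 1 ≤ β₀ ∧ ∀ β : ℝ, β₀ ≤ β → ∀ H : ℕ, 1 ≤ H → (H : ℝ) ≤ β ^ θ + 1 →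
      ∀ (x y : Site 4), ∀ t ∈ Set.Icc (0 : ℝ) 1,
        |Tilt.tiltCum5 ((volume.restrict (smallField H (β ^ (-1 / 2 + κ₃)))).withDensity fun a => ENNReal.ofReal (gaussWeight β H a))
            (tiltU β H) t (chartPlaqCost H x 1 2) (chartPlaqCost H y 1 2)| ≤
          C * (1 + Real.log H) ^ m *
            (((1 + Real.log H) ^ 2 / β ^ 2 + (β ^ (-1 / 2 + κ₃)) ^ 3 / (β * Real.sqrt β)) * ((H : ℝ) ^ 6 / (β * Real.sqrt β))) := by
  obtain ⟨C, m, c₀, hc₀, hC0, hK⟩ := abs_tiltCum5_muD_le_dominant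
  have hθ0 : 0 ≤ θ := hθ.le
  -- the seven largeness conditions
  obtain ⟨b₁, hb₁1, hb₁⟩ := ErrorBudget.exists_forall_natPow_log_le (k := 4) (γ := 1) hθ0 (by push_cast; linarith) one_pos 1 0 0
  obtain ⟨b₂, hb₂1, hb₂⟩ := ErrorBudget.exists_forall_natPow_log_le (k := 2) (γ := 1 / 2 - κ₃) hθ0 (by push_cast; linarith) hc₀ 1 0 0
  obtain ⟨b₃, hb₃1, hb₃⟩ := ErrorBudget.exists_forall_natPow_log_le (k := 2) (γ := 1 - 5 * κ₃) hθ0 (by push_cast; linarith) one_pos 1 0 0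
  obtain ⟨b₄, hb₄1, hb₄⟩ := ErrorBudget.exists_forall_natPow_log_le (k := 4) (γ := 1 - 3 * κ₃) hθ0 (by push_cast; linarith) one_pos 1 0 0
  obtain ⟨b₅, hb₅1, hb₅⟩ := ErrorBudget.exists_forall_natPow_log_le (k := 2) (γ := 3 / 2 - 4 * κ₃) hθ0 (by push_cast; linarith) one_pos 1 0 0
  obtain ⟨b₆, hb₆1, hb₆⟩ := TiltSup.exists_forall_abs_tiltU_le_wide hθ hθ5 hκu one_pos
  obtain ⟨b₇, hb₇1, hb₇⟩ := GaussTail.exists_beta0_half_le_gaussAvg_sfInd hθ0 hκ0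
  refine ⟨14 * C, m, by positivity, max (max (max b₁ b₂) (max b₃ b₄)) (max (max b₅ b₆) b₇),
    le_max_of_le_left (le_max_of_le_left (le_max_of_le_left hb₁1)), fun β hβ H hH hHu x y t ht => ?_⟩
  simp only [max_le_iff] at hβ
  obtain ⟨⟨⟨hβ1, hβ2⟩, hβ3, hβ4⟩, ⟨hβ5, hβ6⟩, hβ7⟩ := hβ
  have hβone : 1 ≤ β := hb₁1.trans hβ1
  have hβ0 : 0 < β := lt_of_lt_of_le one_pos hβone
  have hH1 : (1 : ℝ) ≤ H := by exact_mod_cast hH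
  have hH0 : (0 : ℝ) < H := by linarith
  set s : ℝ := β ^ (-1 / 2 + κ₃) with hs
  have hs0 : 0 < s := Real.rpow_pos_of_pos hβ0 _
  have hs1 : s ≤ 1 := TiltSup.rpow_neg_half_add_le_one hβone (by linarith)
  -- `H⁴ ≤ β`
  have h1 := hb₁ β hβ1 H hH hHu
  simp only [pow_zero, mul_one, one_mul, Real.rpow_one] at h1
  have hH4 : (H : ℝ) ^ 4 ≤ β := by rwa [div_le_one hβ0] at h1
  -- `s·H² ≤ c₀`
  have h2 := hb₂ β hβ2 H hH hHu
  simp only [pow_zero, mul_one, one_mul] at h2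
  have hsH : s * (H : ℝ) ^ 2 ≤ c₀ := by
    rw [hs, TiltSup.rpow_eq_one_div hβ0, one_div_mul_eq_div]; exact h2
  -- the three dominance conditions
  have h3 := hb₃ β hβ3 H hH hHu
  have h4 := hb₄ β hβ4 H hH hHu
  have h5 := hb₅ β hβ5 H hH hHu
  simp only [pow_zero, mul_one, one_mul] at h3 h4 h5
  have hP3 : (H : ℝ) ^ 2 ≤ β ^ (1 - 5 * κ₃) := by rwa [div_le_one (Real.rpow_pos_of_pos hβ0 _)] at h3
  have hP4 : (H : ℝ) ^ 4 ≤ β ^ (1 - 3 * κ₃) := by rwa [div_le_one (Real.rpow_pos_of_pos hβ0 _)] at h4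
  have hP5 : (H : ℝ) ^ 2 ≤ β ^ (3 / 2 - 4 * κ₃) := by rwa [div_le_one (Real.rpow_pos_of_pos hβ0 _)] at h5
  have hsq : (H : ℝ) ^ 2 / Real.sqrt β = (H : ℝ) ^ 2 * (Real.sqrt β)⁻¹ := div_eq_mul_inv _ _
  have hd1 : β * (H : ℝ) ^ 4 * s ^ 5 ≤ (H : ℝ) ^ 2 / Real.sqrt β := by
    have e : β ^ (1 - 5 * κ₃) * (β * s ^ 5) = (Real.sqrt β)⁻¹ := by
      rw [← mul_assoc, ← Real.rpow_add_one hβ0.ne', hs]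
      exact TiltSup.rpow_window_aux hβ0 5 (by push_cast; ring)
    calc β * (H : ℝ) ^ 4 * s ^ 5 = (H : ℝ) ^ 2 * ((H : ℝ) ^ 2 * (β * s ^ 5)) := by ring
      _ ≤ (H : ℝ) ^ 2 * (β ^ (1 - 5 * κ₃) * (β * s ^ 5)) :=
          mul_le_mul_of_nonneg_left (mul_le_mul_of_nonneg_right hP3 (by positivity)) (by positivity)
      _ = (H : ℝ) ^ 2 / Real.sqrt β := by rw [e, hsq]
  have hd2 : (H : ℝ) ^ 6 * s ^ 3 ≤ (H : ℝ) ^ 2 / Real.sqrt β := by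
    have e : β ^ (1 - 3 * κ₃) * s ^ 3 = (Real.sqrt β)⁻¹ := by
      rw [hs]; exact TiltSup.rpow_window_aux hβ0 3 (by push_cast; ring)
    calc (H : ℝ) ^ 6 * s ^ 3 = (H : ℝ) ^ 2 * ((H : ℝ) ^ 4 * s ^ 3) := by ring
      _ ≤ (H : ℝ) ^ 2 * (β ^ (1 - 3 * κ₃) * s ^ 3) :=
          mul_le_mul_of_nonneg_left (mul_le_mul_of_nonneg_right hP4 (by positivity)) (by positivity)
      _ = (H : ℝ) ^ 2 / Real.sqrt β := by rw [e, hsq]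
  have hd3 : (H : ℝ) ^ 4 * s ^ 4 ≤ (H : ℝ) ^ 2 / Real.sqrt β := by
    have e : β ^ (3 / 2 - 4 * κ₃) * s ^ 4 = (Real.sqrt β)⁻¹ := by
      rw [hs]; exact TiltSup.rpow_window_aux hβ0 4 (by push_cast; ring)
    calc (H : ℝ) ^ 4 * s ^ 4 = (H : ℝ) ^ 2 * ((H : ℝ) ^ 2 * s ^ 4) := by ring
      _ ≤ (H : ℝ) ^ 2 * (β ^ (3 / 2 - 4 * κ₃) * s ^ 4) :=
          mul_le_mul_of_nonneg_left (mul_le_mul_of_nonneg_right hP5 (by positivity)) (by positivity)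
      _ = (H : ℝ) ^ 2 / Real.sqrt β := by rw [e, hsq]
  -- `sup_D |tiltU| ≤ 1`, `E₀[1_D] ≥ 1/2`
  have hU1 := hb₆ β hβ6 H hH hHu
  have hD := (hb₇ β hβ7 H hH hHu).1
  rw [show κ₃ - 1 / 2 = -1 / 2 + κ₃ by ring] at hD
  have h := hK H hH β hH4 s hs0 hs1 hsH hd1 hd2 hd3 hU1 hD x y t ht
  calc _ ≤ _ := h
    _ = 14 * C * (1 + Real.log H) ^ m *
          (((1 + Real.log H) ^ 2 / β ^ 2 + s ^ 3 / (β * Real.sqrt β)) * ((H : ℝ) ^ 6 / (β * Real.sqrt β))) := by ring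

end GaussNormalForm

end Summit.QuantumFields.YangMills.Theorems.AllWindowsColdBoxBoxHighLine

end
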